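import Mathlib
import Summits.NavierStokesRegularity.NavierStokesRegularity.Theorems.TaoLadderRungTwoBreakOneShiftSparseClosedForm
import Summits.NavierStokesRegularity.NavierStokesRegularity.Theorems.TaoLadderRungTwoBreakOneShiftB8E8W91Rows
import HarnessLib

/-!
# The one-shift instance B8 @ ε₀ = 2/25, W = 91: every frame / scalar / row hypothesis of
# `exists_surviving_dssWave_of_windowCert_v7s` DISCHARGED IN THE KERNEL (exact rational arithmetic);
# what remains is the CERTIFICATE SIDE only (cell harvest/h2-tao-ladder, seat p2; rung1/INSTANCE-SHEET-T4-0.1-W76.md (the B8 instance follows the same sheet);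
# support for K1(1) = `NoSurvivingDSSOne`, stmt-NavierStokesRegularity-20205 — a counter-instance SHAPE at one
# (ε₀, α), it does not touch the item's quantifier `∃ ε_s ∀ ε₀ ≤ ε_s`)

MODEL lattice only (Tao-type averaged cascade with the comparable circuit table B8, scale ratio `27/25`);
nothing here is a statement about the Navier–Stokes equations; no item is closed; CONDITIONAL theorem.

`exists_surviving_dssWave_of_cert`: for ANY box data `bd` (Krawczyk box on the window, section) with
`|ŷ_{·,0}| ≤ cmax` and shell `0` non-degenerate, IF the window certificate of the frame `frame bd` holds —
`cert : OneShiftWindowCert (frame bd) (2/25) αB8` together with its eight quantitative clauses in the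
engine's EDGE FORM with the printed numbers of the row B8 @ 0.08, W = 91 (Krawczyk inclusion `hwinIn`,
window block `Z = 3.94e-3, S_b = 1.07e-5, S_e = 1.3396e24`, `g ∈ [gLo, gHi]`, `γ = (8.86e-9, 2.48e-16, 1e-60)`,
bottom-shell `(1.11e-8, 1.82e-5, 1e-60)`, per-shell `vmaxB8 / χbB8 / χeB8`, amplitude hulls `AB8`, wake entry
`A₁ = 3.02e-6`) — THEN the bi-infinite B8 lattice at `1 + ε₀ = 27/25` carries a surviving admissible DSS
blow-up wave (`IsDSSWave ∧ Surviving 1 ∧ Φ ≢ 0`), for a table in `InTableClass 14`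
(`exists_inTableClass_surviving_dssWave_of_cert`).  All 60-odd non-certificate hypotheses of `…_v7s`
(closed-form frame, scalars, the nine finite rows incl. the four `quadTermLip` rows via
`quadTermLip_le_of_bounds`, `Λ₀ = (27/25)^{5/2} ∈ [1.2121, 1.2122]` via `Λ₀² = 1.4693280768`) are PROVED here with
`q = 13/25`, `S = 2.62`, `Q = 0.579`, `κ = 3.7e-5`, `r₀ = 1.5e-5` (python exact-rational twin:
rung1/num4c/inst_exact_rows.py, row B8E8W91, 92 checks).  The certificate side is the engine's validated window run
(interval arithmetic, seat engine v7.5 UNAUDITED) — NOT a kernel object: this theorem is exactly as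
conditional as that.
-/

noncomputable section

-- the sub-problem namespace repeats the summit name by design (D-0017)
set_option linter.dupNamespace false

namespace Summit.NavierStokesRegularity.NavierStokesRegularity.Theorems

namespace DSSOneShift

open Set Literature.Analysis.FluidPDE Literature.Analysis.FluidPDE.TaoCascade CertificateGlueOn
open OneShiftFrame

namespace B8E8W91

variable (bd : BoxData)

/-! ### The instance theorem -/

/-- **B8 @ ε₀ = 2/25, W = 91: a surviving admissible DSS blow-up wave of the bi-infinite B8 lattice, CONDITIONAL
ON THE WINDOW CERTIFICATE ONLY.**  Every frame / scalar / row hypothesis of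
`exists_surviving_dssWave_of_windowCert_v7s` is discharged by exact rational arithmetic in the kernel; the
hypotheses that remain are the certificate side in the engine's edge form with the printed numbers of the row of
record (kit j304115): the window certificate `cert` of the frame `frame bd`, the window amplitude hulls
`hAwin`, the hull `g ∈ [gLo, gHi]` (`hgl`), the window-block Lipschitz numbers (`hWedge`: Z = 3.94e-3,
S_b = 1.07e-5, S_e = 1.3396e24), the renormalisation-factor Lipschitz numbers (`hγedge`), the bottom-shell
Lipschitz numbers (`hZedge`), the per-shell ones (`hDedge`), the Krawczyk inclusion (`hwinIn`), the wake
entry `A₁ = 3.02e-6` (`hA1`).  Those are what p2's interval engine v7.5 VALIDATES (unaudited) and are NOT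
kernel objects.  Model lattice only; nothing about Navier–Stokes; does not close stmt-20205 (one `(ε₀, α)`).
[cite: Tao2016AveragedNS, §4 Lemma 4.1 (4.8), §5.3–§6; cell vocabulary, harvest/h2-tao-ladder rung1/INSTANCE-SHEET-T4-0.1-W76.md (the B8 instance follows the same sheet), rung1/KERNEL-STAGE3-PLAN.md §6, rung1/RUNG1-P2G8-REPORT.md §33–§34] -/
theorem exists_surviving_dssWave_of_cert (cert : OneShiftWindowCert (frame bd) (2 / 25) αB8)
    (hAwin : ∀ w, (frame bd).Adm w → ∀ j k', (frame bd).InWindow k' → ∀ s ∈ Icc 0 (frame bd).τhi,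
      |(frame bd).fullFamily cert w j k' s| ≤ AB8 k')
    (hgl : ∀ w, (frame bd).Adm w →
      gLo ≤ gfac (slice ((frame bd).fullFamily cert w) ((frame bd).decodeTau w)) ∧
        gfac (slice ((frame bd).fullFamily cert w) ((frame bd).decodeTau w)) ≤ gHi)
    (hWedge : ∀ u v, (frame bd).AdmLip RB8 u → (frame bd).AdmLip RB8 v → ∀ B E : ℝ,
      (∀ i, ∀ t ∈ Icc 0 (frame bd).τhi, |(frame bd).decodeTail u i (-1) t - (frame bd).decodeTail v i (-1) t| ≤ B) →
      (∀ i, ∀ t ∈ Icc 0 (frame bd).τhi,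
        |(frame bd).decodeTail u i (frame bd).W t - (frame bd).decodeTail v i (frame bd).W t| ≤ E) →
        dist ((frame bd).rawWindow cert u) ((frame bd).rawWindow cert v) ≤
          394 / 10 ^ 5 * dist u v + 107 / 10 ^ 7 * B + 13396 * 10 ^ 20 * E)
    (hγedge : ∀ u v, (frame bd).AdmLip RB8 u → (frame bd).AdmLip RB8 v → ∀ B E : ℝ,
      (∀ i, ∀ t ∈ Icc 0 (frame bd).τhi, |(frame bd).decodeTail u i (-1) t - (frame bd).decodeTail v i (-1) t| ≤ B) →
      (∀ i, ∀ t ∈ Icc 0 (frame bd).τhi,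
        |(frame bd).decodeTail u i (frame bd).W t - (frame bd).decodeTail v i (frame bd).W t| ≤ E) →
        |gfac (slice ((frame bd).fullFamily cert u) ((frame bd).decodeTau u)) -
          gfac (slice ((frame bd).fullFamily cert v) ((frame bd).decodeTau v))| ≤
          886 / 10 ^ 11 * dist u v + 248 / 10 ^ 18 * B + 1 / 10 ^ 60 * E)
    (hZedge : ∀ u v, (frame bd).AdmLip RB8 u → (frame bd).AdmLip RB8 v → ∀ i, ∀ B E : ℝ,
      (∀ i, ∀ t ∈ Icc 0 (frame bd).τhi, |(frame bd).decodeTail u i (-1) t - (frame bd).decodeTail v i (-1) t| ≤ B) →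
      (∀ i, ∀ t ∈ Icc 0 (frame bd).τhi,
        |(frame bd).decodeTail u i (frame bd).W t - (frame bd).decodeTail v i (frame bd).W t| ≤ E) →
        |(frame bd).fullFamily cert u i 0 ((frame bd).decodeTau u) -
          (frame bd).fullFamily cert v i 0 ((frame bd).decodeTau v)| ≤
          111 / 10 ^ 10 * dist u v + 182 / 10 ^ 7 * B + 1 / 10 ^ 60 * E)
    (hDedge : ∀ u v, (frame bd).AdmLip RB8 u → (frame bd).AdmLip RB8 v → ∀ j k', (frame bd).InWindow k' →
      ∀ s ∈ Icc 0 (frame bd).τhi, ∀ B E : ℝ,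
      (∀ i, ∀ t ∈ Icc 0 (frame bd).τhi, |(frame bd).decodeTail u i (-1) t - (frame bd).decodeTail v i (-1) t| ≤ B) →
      (∀ i, ∀ t ∈ Icc 0 (frame bd).τhi,
        |(frame bd).decodeTail u i (frame bd).W t - (frame bd).decodeTail v i (frame bd).W t| ≤ E) →
        |(frame bd).fullFamily cert u j k' s - (frame bd).fullFamily cert v j k' s| ≤
          vmaxB8 k' * dist u v + χbB8 k' * B + χeB8 k' * E)
    (hwinIn : ∀ u, (frame bd).AdmLip RB8 u →
      (∀ i k, |((frame bd).rawWindow cert u).1 i k| ≤ 1) ∧ |((frame bd).rawWindow cert u).2| ≤ 1)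
    (hA1 : ∀ w, (frame bd).Adm w → ∀ i,
      |gfac (slice ((frame bd).fullFamily cert w) ((frame bd).decodeTau w)) *
          (frame bd).fullFamily cert w i 0 ((frame bd).decodeTau w) - (frame bd).tubeC i (-1)| ≤ 302 / 10 ^ 8) :
    ∃ (T : ℝ) (Φ : Unit → ℝ → Em 4), 0 < T ∧ IsDSSWave (2 / 25) αB8 (Equiv.refl Unit) T Φ ∧
      Surviving 1 (2 / 25) T ∧ ∃ x, Φ () x ≠ 0 := by
  obtain ⟨hΛlo, hΛhi⟩ := bigLam_e8_bounds
  have hΛ1 : 1 ≤ bigLam (2 / 25 : ℝ) := one_le_bigLam (by norm_num)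
  have hpos : 0 < bigLam (2 / 25 : ℝ) := by linarith
  have hw1 : 0 < (frame bd).wt (-1) := by rw [frame_wt]; exact wtB8_pos _
  have hwW : 0 < (frame bd).wt (frame bd).W := by rw [frame_wt]; exact wtB8_pos _
  exact (frame bd).exists_surviving_dssWave_of_windowCert_v7s cert RB8 AB8 vmaxB8 χbB8 χeB8
    (Mα := 1) (Q := Q) (β := βw) (q := 13 / 25) (gLo := gLo) (gHi := gHi) (A1 := 302 / 10 ^ 8) (S := S)
    (ω := 1) (θ := θw) (κ := κw) (ωt := ωt) (ϑ := 1 / 2) (abart := abart) (ϑR := 1 / 2) (εR := εR)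
    (ghat := ghat) (cmax := cmax) (r₀ := r₀) (δ' := 1 / 100) (c₀ := fun i => bd.yc i 0)
    (hε := by norm_num) (hΛ1 := hΛ1) (hMα := zero_le_one) (hα := abs_αB8_le_one)
    (hW1 := by simp [frame]) (hq := by norm_num) (hq1 := by norm_num) (hA0 := AB8_nonneg) (hAwin := hAwin)
    (hR0 := RB8_nonneg) (hS := tableAbsSum_αB8_le) (hRW := RB8_wake) (hRT := RB8_top)
    (hRBm1 := row_RBm1) (hRBW := row_RBW bd) (hgl := hgl)
    (hgLo1 := by unfold gLo; norm_num) (hgHi2 := by unfold gHi; norm_num)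
    (hgHiΛ := lt_of_lt_of_le (by unfold gHi; norm_num) hΛlo)
    (hβgLo := lt_of_lt_of_le (by unfold βw gHi gLo; norm_num)
      (mul_le_mul_of_nonneg_left hΛlo (by unfold gLo; norm_num)))
    (hĝlo := by unfold gLo ghat; norm_num) (hĝgHi := by unfold ghat gHi; norm_num)
    (hWedge := hWedge) (hγedge := hγedge) (hZedge := hZedge) (hDedge := hDedge) (hqX := row_qX bd)
    (hDwin0 := fun k' _ => add_nonneg (add_nonneg (vmaxB8_nonneg k') (mul_nonneg (χbB8_nonneg k') hw1.le))
      (mul_nonneg (χeB8_nonneg k') hwW.le))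
    (hγ0 := add_nonneg (add_nonneg (by norm_num) (mul_nonneg (by norm_num) hw1.le))
      (mul_nonneg (by norm_num) hwW.le))
    (hθ := by unfold θw gHi; norm_num) (hβ1 := by unfold βw gHi; norm_num)
    (hβθ := by unfold βw θw gHi; norm_num) (hβΛ := le_trans (by unfold βw gHi; norm_num) hΛlo)
    (hω := zero_le_one) (hδ' := by norm_num) (hβge := le_rfl) (hr₀ := by unfold r₀; norm_num)
    (hκ := by unfold κw; norm_num) (hc := bd.yc_le) (hQ := by unfold cmax r₀ κw Q; norm_num)
    (hσξ := by
      rw [mul_inv_le_iff₀ hpos]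
      exact le_trans (by unfold βw gHi; norm_num) (mul_le_mul_of_nonneg_left hΛlo (by unfold gHi; norm_num)))
    (hwtW := wtB8_wake) (htubeRW := tubeRB8_wake) (htubeCW := tubeCB8_wake fun i => bd.yc i 0) (hAW := AB8_wake)
    (hϑ0 := by norm_num) (hϑ1 := by norm_num) (hϑR := by norm_num) (hϑRϑ := le_rfl)
    (hϑRΛ := by linarith) (hωt := by unfold ωt; norm_num)
    (hAlast := by show AB8 (((91 : ℕ) : ℤ) - 1) ≤ abart; norm_num [AB8])
    (hεab := by unfold εR abart; norm_num)
    (hwtT := wtB8_top) (htubeRT := tubeRB8_top) (htubeCT := tubeCB8_top fun i => bd.yc i 0) (hAT := AB8_top)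
    (hfirstW := row_firstW bd) (hfirstWS := row_firstWS bd) (hfirstT := row_firstT bd) (hfirstTS := row_firstTS bd)
    (hrowB := row_B bd) (hrowT := row_T bd) (hrow1 := row_1 bd)
    (hwinIn := hwinIn) (hA1 := hA1) (hQA := by unfold Q; norm_num [AB8]) (hne := bd.yc_ne)

/-- **Counter-instance SHAPE for K1(1) at one scale ratio, conditional on the certificate**: under the same
certificate-side hypotheses, the comparable class `E₂(14)` contains a table (B8, the cell's second comparable table) carrying a
surviving admissible DSS blow-up wave at `1 + ε₀ = 27/25`.  (K1(1) = `NoSurvivingDSSOne` asks for NO such wave for all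
`ε₀ ≤ ε_s(R)` with `ε_s` free, so one `ε₀` does not decide it; B8 is the cell's second comparable table.)  Model lattice only; nothing about Navier–Stokes.
[cite: Tao2016AveragedNS, §4 (4.2)–(4.3), §6.1, §5.3–§6; cell vocabulary (`InTableClass`), module …CircuitTableT4, harvest/h2-tao-ladder rung1/RUNG1-P2G8-REPORT.md §32–§34] -/
theorem exists_inTableClass_surviving_dssWave_of_cert (cert : OneShiftWindowCert (frame bd) (2 / 25) αB8)
    (hAwin : ∀ w, (frame bd).Adm w → ∀ j k', (frame bd).InWindow k' → ∀ s ∈ Icc 0 (frame bd).τhi,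
      |(frame bd).fullFamily cert w j k' s| ≤ AB8 k')
    (hgl : ∀ w, (frame bd).Adm w →
      gLo ≤ gfac (slice ((frame bd).fullFamily cert w) ((frame bd).decodeTau w)) ∧
        gfac (slice ((frame bd).fullFamily cert w) ((frame bd).decodeTau w)) ≤ gHi)
    (hWedge : ∀ u v, (frame bd).AdmLip RB8 u → (frame bd).AdmLip RB8 v → ∀ B E : ℝ,
      (∀ i, ∀ t ∈ Icc 0 (frame bd).τhi, |(frame bd).decodeTail u i (-1) t - (frame bd).decodeTail v i (-1) t| ≤ B) →
      (∀ i, ∀ t ∈ Icc 0 (frame bd).τhi,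
        |(frame bd).decodeTail u i (frame bd).W t - (frame bd).decodeTail v i (frame bd).W t| ≤ E) →
        dist ((frame bd).rawWindow cert u) ((frame bd).rawWindow cert v) ≤
          394 / 10 ^ 5 * dist u v + 107 / 10 ^ 7 * B + 13396 * 10 ^ 20 * E)
    (hγedge : ∀ u v, (frame bd).AdmLip RB8 u → (frame bd).AdmLip RB8 v → ∀ B E : ℝ,
      (∀ i, ∀ t ∈ Icc 0 (frame bd).τhi, |(frame bd).decodeTail u i (-1) t - (frame bd).decodeTail v i (-1) t| ≤ B) →
      (∀ i, ∀ t ∈ Icc 0 (frame bd).τhi,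
        |(frame bd).decodeTail u i (frame bd).W t - (frame bd).decodeTail v i (frame bd).W t| ≤ E) →
        |gfac (slice ((frame bd).fullFamily cert u) ((frame bd).decodeTau u)) -
          gfac (slice ((frame bd).fullFamily cert v) ((frame bd).decodeTau v))| ≤
          886 / 10 ^ 11 * dist u v + 248 / 10 ^ 18 * B + 1 / 10 ^ 60 * E)
    (hZedge : ∀ u v, (frame bd).AdmLip RB8 u → (frame bd).AdmLip RB8 v → ∀ i, ∀ B E : ℝ,
      (∀ i, ∀ t ∈ Icc 0 (frame bd).τhi, |(frame bd).decodeTail u i (-1) t - (frame bd).decodeTail v i (-1) t| ≤ B) →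
      (∀ i, ∀ t ∈ Icc 0 (frame bd).τhi,
        |(frame bd).decodeTail u i (frame bd).W t - (frame bd).decodeTail v i (frame bd).W t| ≤ E) →
        |(frame bd).fullFamily cert u i 0 ((frame bd).decodeTau u) -
          (frame bd).fullFamily cert v i 0 ((frame bd).decodeTau v)| ≤
          111 / 10 ^ 10 * dist u v + 182 / 10 ^ 7 * B + 1 / 10 ^ 60 * E)
    (hDedge : ∀ u v, (frame bd).AdmLip RB8 u → (frame bd).AdmLip RB8 v → ∀ j k', (frame bd).InWindow k' →
      ∀ s ∈ Icc 0 (frame bd).τhi, ∀ B E : ℝ,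
      (∀ i, ∀ t ∈ Icc 0 (frame bd).τhi, |(frame bd).decodeTail u i (-1) t - (frame bd).decodeTail v i (-1) t| ≤ B) →
      (∀ i, ∀ t ∈ Icc 0 (frame bd).τhi,
        |(frame bd).decodeTail u i (frame bd).W t - (frame bd).decodeTail v i (frame bd).W t| ≤ E) →
        |(frame bd).fullFamily cert u j k' s - (frame bd).fullFamily cert v j k' s| ≤
          vmaxB8 k' * dist u v + χbB8 k' * B + χeB8 k' * E)
    (hwinIn : ∀ u, (frame bd).AdmLip RB8 u →
      (∀ i k, |((frame bd).rawWindow cert u).1 i k| ≤ 1) ∧ |((frame bd).rawWindow cert u).2| ≤ 1)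
    (hA1 : ∀ w, (frame bd).Adm w → ∀ i,
      |gfac (slice ((frame bd).fullFamily cert w) ((frame bd).decodeTau w)) *
          (frame bd).fullFamily cert w i 0 ((frame bd).decodeTau w) - (frame bd).tubeC i (-1)| ≤ 302 / 10 ^ 8) :

    ∃ α : Fin 4 → Fin 4 → Fin 4 → ℤ × ℤ × ℤ → ℝ, InTableClass 14 α ∧
      ∃ (T : ℝ) (Φ : Unit → ℝ → Em 4), 0 < T ∧ IsDSSWave (2 / 25) α (Equiv.refl Unit) T Φ ∧
        Surviving 1 (2 / 25) T ∧ ∃ x, Φ () x ≠ 0 :=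
  ⟨αB8, inTableClass_circuitTable_B8 (ε₀ := 2 / 25) (by norm_num) (by norm_num),
    exists_surviving_dssWave_of_cert bd cert hAwin hgl hWedge hγedge hZedge hDedge hwinIn hA1⟩

end B8E8W91

end DSSOneShift

end Summit.NavierStokesRegularity.NavierStokesRegularity.Theorems
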